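import Summits.CriticalPhenomena.SAWScalingLimit.Theorems.SAWDevelopingMapNoFoldBoundBoundaryLayerCore
import Summits.CriticalPhenomena.SAWScalingLimit.Theorems.SAWDevelopingMapNoFoldBoundSourceLoopReduction
import Summits.CriticalPhenomena.SAWScalingLimit.Theorems.SAWDevelopingMapNoFoldBoundLoopWinding
import Summits.CriticalPhenomena.SAWScalingLimit.Theorems.SAWDevelopingMapNoFoldBoundLocalTurns

/-!
# `NoFoldBound`, line Ideator3Sketch — interior vertices I: the slit source triples

Crux `NoFoldBound` (stmt-CriticalPhenomena-8296), route `SAWDevelopingMap`. At a vertex `v` off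
the source mid-edge all of whose neighbours lie in the (simply connected) domain, every first
arrival `γ` at a port `{v, e}` turns `v` into the SOURCE vertex of the slit domain `Λ ∖ γ`
(entered through the door `{e, v}`); the exact source law (`SourceLoopBound.sourcePort`), the
loop winding (`stub_loopWinding`) and reciprocity evaluate the observable of the slit domain at
the three mid-edges of `v` (`slit_source_values`), and the three modes of such a triple are the
real numbers `α_T − √3x_cZ` (sum), `β_T + √3x_cZ` (Beltrami, positive labelling) and `0` (DCS
labelling: `source_dcs_mode`). Slit simple connectivity enters as the hypothesis `hSSC`
(registered stub `stub_slitSC`).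
-/

noncomputable section

open scoped BigOperators
open Literature.Probability.LatticeModels Literature.Probability.RandomPlanarGeometry.SAW

namespace Summit.CriticalPhenomena.SAWScalingLimit.Theorems.SAWDevelopingMapNoFoldBound

/-! ## The DCS mode of the source triple vanishes -/

/-- The DCS mode of the source triple (anti-cyclic labelling `(u, w₋, w₊)`) vanishes:
`1 + ω(x e(−π/3) + x e(−4π/3) Z) + ω²(x e(π/3) + x e(4π/3) Z) = 0` — the constant part is
`1 − 2x_c cos(π/8) = 0` and the loop parts cancel (`e^{i3π/2} + e^{iπ/2} = 0`). [folklore] -/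
theorem source_dcs_mode (Z : ℝ) :
    (1 : ℂ) + Complex.exp (2 * Real.pi * Complex.I / 3) *
        (hexCriticalFugacity * Complex.exp (-Complex.I * (5 / 8 : ℝ) * ((-(Real.pi / 3) : ℝ) : ℂ)) +
          hexCriticalFugacity * Complex.exp (-Complex.I * (5 / 8 : ℝ) * ((4 * -(Real.pi / 3) : ℝ) : ℂ)) * Z) +
      Complex.exp (2 * Real.pi * Complex.I / 3) ^ 2 *
        (hexCriticalFugacity * Complex.exp (-Complex.I * (5 / 8 : ℝ) * ((Real.pi / 3 : ℝ) : ℂ)) +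
          hexCriticalFugacity * Complex.exp (-Complex.I * (5 / 8 : ℝ) * ((4 * (Real.pi / 3) : ℝ) : ℂ)) * Z) =
      0 := by
  have h1 := Complex.two_cos ((7 * Real.pi / 8 : ℝ) : ℂ)
  have c1 : Real.cos (7 * Real.pi / 8) = -Real.cos (Real.pi / 8) := by
    rw [show (7 * Real.pi / 8 : ℝ) = Real.pi - Real.pi / 8 by ring, Real.cos_pi_sub]
  rw [← Complex.ofReal_cos, c1] at h1
  have h2 := Complex.two_cos ((Real.pi / 2 : ℝ) : ℂ)
  rw [← Complex.ofReal_cos, Real.cos_pi_div_two] at h2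
  have e1 : Complex.exp (2 * Real.pi * Complex.I / 3) *
      Complex.exp (-Complex.I * (5 / 8 : ℝ) * ((-(Real.pi / 3) : ℝ) : ℂ)) =
      Complex.exp (((7 * Real.pi / 8 : ℝ) : ℂ) * Complex.I) := by
    rw [← Complex.exp_add]; congr 1; push_cast; ring
  have e2 : Complex.exp (2 * Real.pi * Complex.I / 3) ^ 2 *
      Complex.exp (-Complex.I * (5 / 8 : ℝ) * ((Real.pi / 3 : ℝ) : ℂ)) =
      Complex.exp (-((7 * Real.pi / 8 : ℝ) : ℂ) * Complex.I) := by
    rw [sq, ← Complex.exp_add, ← Complex.exp_add,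
      show (2 * Real.pi * Complex.I / 3 + 2 * Real.pi * Complex.I / 3 +
          -Complex.I * ((5 / 8 : ℝ) : ℂ) * ((Real.pi / 3 : ℝ) : ℂ) : ℂ) =
        -((7 * Real.pi / 8 : ℝ) : ℂ) * Complex.I + 2 * Real.pi * Complex.I by push_cast; ring,
      Complex.exp_add, Complex.exp_two_pi_mul_I, mul_one]
  have e3 : Complex.exp (2 * Real.pi * Complex.I / 3) *
      Complex.exp (-Complex.I * (5 / 8 : ℝ) * ((4 * -(Real.pi / 3) : ℝ) : ℂ)) =
      Complex.exp (-((Real.pi / 2 : ℝ) : ℂ) * Complex.I) := by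
    rw [← Complex.exp_add,
      show (2 * Real.pi * Complex.I / 3 + -Complex.I * ((5 / 8 : ℝ) : ℂ) * ((4 * -(Real.pi / 3) : ℝ) : ℂ) : ℂ) =
        -((Real.pi / 2 : ℝ) : ℂ) * Complex.I + 2 * Real.pi * Complex.I by push_cast; ring,
      Complex.exp_add, Complex.exp_two_pi_mul_I, mul_one]
  have e4 : Complex.exp (2 * Real.pi * Complex.I / 3) ^ 2 *
      Complex.exp (-Complex.I * (5 / 8 : ℝ) * ((4 * (Real.pi / 3) : ℝ) : ℂ)) =
      Complex.exp (((Real.pi / 2 : ℝ) : ℂ) * Complex.I) := by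
    rw [sq, ← Complex.exp_add, ← Complex.exp_add]; congr 1; push_cast; ring
  have expand : (1 : ℂ) + Complex.exp (2 * Real.pi * Complex.I / 3) *
        (hexCriticalFugacity * Complex.exp (-Complex.I * (5 / 8 : ℝ) * ((-(Real.pi / 3) : ℝ) : ℂ)) +
          hexCriticalFugacity * Complex.exp (-Complex.I * (5 / 8 : ℝ) * ((4 * -(Real.pi / 3) : ℝ) : ℂ)) * Z) +
      Complex.exp (2 * Real.pi * Complex.I / 3) ^ 2 *
        (hexCriticalFugacity * Complex.exp (-Complex.I * (5 / 8 : ℝ) * ((Real.pi / 3 : ℝ) : ℂ)) +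
          hexCriticalFugacity * Complex.exp (-Complex.I * (5 / 8 : ℝ) * ((4 * (Real.pi / 3) : ℝ) : ℂ)) * Z) =
      1 + hexCriticalFugacity * (Complex.exp (2 * Real.pi * Complex.I / 3) *
          Complex.exp (-Complex.I * (5 / 8 : ℝ) * ((-(Real.pi / 3) : ℝ) : ℂ)) +
        Complex.exp (2 * Real.pi * Complex.I / 3) ^ 2 *
          Complex.exp (-Complex.I * (5 / 8 : ℝ) * ((Real.pi / 3 : ℝ) : ℂ))) +
      hexCriticalFugacity * Z * (Complex.exp (2 * Real.pi * Complex.I / 3) *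
          Complex.exp (-Complex.I * (5 / 8 : ℝ) * ((4 * -(Real.pi / 3) : ℝ) : ℂ)) +
        Complex.exp (2 * Real.pi * Complex.I / 3) ^ 2 *
          Complex.exp (-Complex.I * (5 / 8 : ℝ) * ((4 * (Real.pi / 3) : ℝ) : ℂ))) := by ring
  rw [expand, e1, e2, e3, e4]
  have hx : (1 : ℂ) - 2 * hexCriticalFugacity * Real.cos (Real.pi / 8) = 0 := by
    have := HV.two_mul_xc_mul_cos
    rw [sub_eq_zero]; exact_mod_cast this.symm
  push_cast at h1 h2 hx ⊢
  linear_combination (-(hexCriticalFugacity : ℂ)) * h1 + (-((hexCriticalFugacity : ℂ) * Z)) * h2 + hx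

/-! ## The slit source triples -/

/-- The last vertex of a first arrival at the port `{v, w}` (a nontrivial walk to `{v, w}`
avoiding `v`) is `w`; in particular `w ∈ γ.verts`. [folklore] -/
theorem mem_verts_of_firstArrival {Λ : Finset HexVertex} {a : Sym2 HexVertex} {v w : HexVertex}
    (hva : v ∉ a) (γ : HexMidEdgeSAW Λ a s(v, w)) (hγ : v ∉ γ.verts) : w ∈ γ.verts := by
  have hne : γ.verts ≠ [] := fun h => hva (by rw [γ.eq_of_nil h]; exact Sym2.mem_mk_left _ _)
  have hlast := γ.getLast_mem (γ.verts.getLast hne) (List.getLast?_eq_getLast_of_ne_nil hne)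
  have hmem := List.getLast_mem hne
  rcases Sym2.mem_iff.1 hlast with h | h
  · rw [h] at hmem; exact absurd hmem hγ
  · rwa [h] at hmem

/-- **The slit source triple.** Let `γ` be a first arrival at the port `e` of the vertex `v`
(all of whose neighbours `e, p, q` lie in the simply connected domain `Λ`, `v` off the source
mid-edge), with the one-step turns `e → v → p = +π/3`, `e → v → q = −π/3`. In the slit domain
`Λ ∖ γ` — simply connected by the hypothesis `hSSC` — `v` is the source vertex entered through the
door `{e, v}`, and the exact source law evaluates the observable at the three mid-edges of `v`:
`F' {v,e} = 1`, `F' {v,p} = x e(π/3) + x e(4π/3) Z`, `F' {v,q} = x e(−π/3) + x e(−4π/3) Z` with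
`Z` the returning-loop sum of `(Λ ∖ γ) ∖ {v}` from `{v,p}` to `{v,q}` (reciprocity makes the two
orientations agree). [folklore] -/
theorem slit_source_values
    (hSSC : ∀ (Λ : Finset HexVertex), hexDomainSimplyConnected Λ → ∀ a ∈ hexDomainBoundary Λ,
      ∀ (z : Sym2 HexVertex) (γ : HexMidEdgeSAW Λ a z), hexDomainSimplyConnected (Λ \ γ.verts.toFinset))
    {Λ : Finset HexVertex} (hΛ : hexDomainSimplyConnected Λ) {a : Sym2 HexVertex}
    (ha : a ∈ hexDomainBoundary Λ) {v e p q : HexVertex} (hv : v ∈ Λ) (hva : v ∉ a)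
    (he : hexGraph.Adj v e) (hp : hexGraph.Adj v p) (hq : hexGraph.Adj v q)
    (hep : e ≠ p) (heq : e ≠ q) (hpq : p ≠ q)
    (Tep : winding [hexMidpoint s(e, v), hexCenter v, hexMidpoint s(v, p)] = Real.pi / 3)
    (Teq : winding [hexMidpoint s(e, v), hexCenter v, hexMidpoint s(v, q)] = -(Real.pi / 3))
    (γ : HexMidEdgeSAW Λ a s(v, e)) (hγ : v ∉ γ.verts) :
    hexParafermionicObservable (Λ \ γ.verts.toFinset) s(e, v) hexCriticalFugacity (5 / 8) s(v, e) = 1 ∧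
    hexParafermionicObservable (Λ \ γ.verts.toFinset) s(e, v) hexCriticalFugacity (5 / 8) s(v, p) =
      hexCriticalFugacity * Complex.exp (-Complex.I * (5 / 8 : ℝ) * ((Real.pi / 3 : ℝ) : ℂ)) +
      hexCriticalFugacity * Complex.exp (-Complex.I * (5 / 8 : ℝ) * ((4 * (Real.pi / 3) : ℝ) : ℂ)) *
        ((∑ δ : HexMidEdgeSAW ((Λ \ γ.verts.toFinset).erase v) s(v, p) s(v, q),
          hexCriticalFugacity ^ δ.length : ℝ) : ℂ) ∧
    hexParafermionicObservable (Λ \ γ.verts.toFinset) s(e, v) hexCriticalFugacity (5 / 8) s(v, q) =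
      hexCriticalFugacity * Complex.exp (-Complex.I * (5 / 8 : ℝ) * ((-(Real.pi / 3) : ℝ) : ℂ)) +
      hexCriticalFugacity * Complex.exp (-Complex.I * (5 / 8 : ℝ) * ((4 * -(Real.pi / 3) : ℝ) : ℂ)) *
        ((∑ δ : HexMidEdgeSAW ((Λ \ γ.verts.toFinset).erase v) s(v, p) s(v, q),
          hexCriticalFugacity ^ δ.length : ℝ) : ℂ) := by
  set Λ' : Finset HexVertex := Λ \ γ.verts.toFinset with hΛ'
  have hΛ'sc : hexDomainSimplyConnected Λ' := hSSC Λ hΛ a ha _ γ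
  have heγ : e ∈ γ.verts := mem_verts_of_firstArrival hva γ hγ
  have he' : e ∉ Λ' := fun h => (Finset.mem_sdiff.1 h).2 (List.mem_toFinset.2 heγ)
  have hv' : v ∈ Λ' := Finset.mem_sdiff.2 ⟨hv, fun h => hγ (List.mem_toFinset.1 h)⟩
  have hdoor : s(e, v) ∈ hexDomainBoundary Λ' :=
    ⟨(SimpleGraph.mem_edgeSet hexGraph).2 he.symm, e, v, rfl, hv', he'⟩
  set Z : ℝ := ∑ δ : HexMidEdgeSAW (Λ'.erase v) s(v, p) s(v, q), hexCriticalFugacity ^ δ.length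
    with hZ
  -- the returning loops of the slit domain
  have hLqp : hexParafermionicObservable (Λ'.erase v) s(v, q) hexCriticalFugacity (5 / 8) s(v, p) =
      Complex.exp (-Complex.I * (5 / 8 : ℝ) * ((-5 * -(Real.pi / 3) : ℝ) : ℂ)) * (Z : ℂ) := by
    rw [hexParafermionicObservable_def, hZ, ← loopSum_symm hp hq hpq]
    refine sum_weight_eq_of_winding_eq _ _ _ fun δ => ?_
    rw [stub_loopWinding Λ' hΛ'sc e v p q he' hv' he hp hq hep heq hpq δ, Teq]
  have hLpq : hexParafermionicObservable (Λ'.erase v) s(v, p) hexCriticalFugacity (5 / 8) s(v, q) =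
      Complex.exp (-Complex.I * (5 / 8 : ℝ) * ((-5 * (Real.pi / 3) : ℝ) : ℂ)) * (Z : ℂ) := by
    rw [hexParafermionicObservable_def, hZ]
    refine sum_weight_eq_of_winding_eq _ _ _ fun δ => ?_
    rw [stub_loopWinding Λ' hΛ'sc e v q p he' hv' he hq hp heq hep hpq.symm δ, Tep]
  refine ⟨?_, ?_, ?_⟩
  · rw [Sym2.eq_swap (a := v)]
    exact hexParafermionicObservable_self hdoor _ _
  · rw [SourceLoopBound.sourcePort he' hv' he hp hq hep heq hpq, Tep, Teq, hLqp, xexp_mul_exp_mul,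
      show (-(Real.pi / 3) + -5 * -(Real.pi / 3) : ℝ) = 4 * (Real.pi / 3) by ring]
  · rw [SourceLoopBound.sourcePort he' hv' he hq hp heq hep hpq.symm, Tep, Teq, hLpq,
      xexp_mul_exp_mul, show (Real.pi / 3 + -5 * (Real.pi / 3) : ℝ) = 4 * -(Real.pi / 3) by ring]

/-- Regrouping three restricted sums with a common weight. [folklore] -/
theorem sum_ite_mul_add₃ {ι : Type*} (s : Finset ι) (P : ι → Prop) [DecidablePred P]
    (c X₀ X₁ X₂ : ι → ℂ) :
    (∑ i ∈ s, if P i then c i * X₀ i else 0) + (∑ i ∈ s, if P i then c i * X₁ i else 0) +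
      (∑ i ∈ s, if P i then c i * X₂ i else 0) =
      ∑ i ∈ s, if P i then c i * (X₀ i + X₁ i + X₂ i) else 0 := by
  rw [← Finset.sum_add_distrib, ← Finset.sum_add_distrib]
  refine Finset.sum_congr rfl fun i _ => ?_
  split_ifs <;> ring

/-- Regrouping three restricted sums with a common weight and coefficients. [folklore] -/
theorem sum_ite_mul_add₃' {ι : Type*} (s : Finset ι) (P : ι → Prop) [DecidablePred P]
    (c X₀ X₁ X₂ : ι → ℂ) (m₁ m₂ : ℂ) :
    (∑ i ∈ s, if P i then c i * X₀ i else 0) + m₁ * (∑ i ∈ s, if P i then c i * X₁ i else 0) +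
      m₂ * (∑ i ∈ s, if P i then c i * X₂ i else 0) =
      ∑ i ∈ s, if P i then c i * (X₀ i + m₁ * X₁ i + m₂ * X₂ i) else 0 := by
  rw [Finset.mul_sum, Finset.mul_sum, ← Finset.sum_add_distrib, ← Finset.sum_add_distrib]
  refine Finset.sum_congr rfl fun i _ => ?_
  split_ifs <;> ring

/-- `ω³ = 1` for `ω = e^{2πi/3}`. [folklore] -/
theorem omega_pow_three : Complex.exp (2 * Real.pi * Complex.I / 3) ^ 3 = 1 := by
  rw [← Complex.exp_nat_mul]
  push_cast
  rw [show (3 : ℂ) * (2 * Real.pi * Complex.I / 3) = 2 * Real.pi * Complex.I by ring]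
  exact Complex.exp_two_pi_mul_I

/-- `|ω| = 1` for `ω = e^{2πi/3}`. [folklore] -/
theorem norm_omega : ‖Complex.exp (2 * Real.pi * Complex.I / 3)‖ = 1 := by
  rw [show (2 * Real.pi * Complex.I / 3 : ℂ) = ((2 * Real.pi / 3 : ℝ) : ℂ) * Complex.I by
    push_cast; ring]
  exact Complex.norm_exp_ofReal_mul_I _

end Summit.CriticalPhenomena.SAWScalingLimit.Theorems.SAWDevelopingMapNoFoldBound
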